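import Mathlib
import Summits.NavierStokesRegularity.FluidComputer.AbcFlowFrobeniusConstants
import Summits.NavierStokesRegularity.FluidComputer.HighModePoincare
import Literature.Analysis.FunctionSpaces.TorusLinearisedNSEnergy
import HarnessLib

/-!
# The `L²` tail form of the ABC linearisation on the unit torus: `m_t = x + ν(K+1)² − √2` in the kernel (cap g5, cell `ns-blowup`, 2026-08-26)

HONEST FRAMING (human ruling D-0035): nothing here is a claim about Navier–Stokes blow-up.
WHAT THIS IS NOT: not NS evidence. The `L²` sibling of `AbcFlowFrobeniusConstants.abc_tail_form_le`:
the TAIL SENTENCE of the skew-cut / 3-B-nested certificates of the cell (X0 eigenvalue W-1,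
X0 pair W-2, O3′, O3″, the D2-3L tail at level `η₀`) — «on the modes beyond shell `K` the real part
of the form of `L_R − x` is at most `−(x + ν(K+1)² − s)‖w‖²` with `s = √2`» (SKEWCUT-CERT Thm 1′,
`CertificateAbcSpectrum` docstring, METHOD-O3prime (N4) «far tail: Re λ̃ + ν(K₀+2)² − s») — for the
TREE object `U = Literature.Analysis.FluidPDE.Torus.abcFlow 1 1 1`, in unit-torus scaling
(`X = 2πx`: the operator `νΔ − [(U·∇)· + (·∇)U]` on `(ℝ/2πℤ)³` becomes
`(ν/4π²)Δ − (1/2π)[(U·∇)· + (·∇)U]`):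

* `abs_integral_inner_stretch_abcFlow_le` — `|∫⟪(w·∇)U, w⟫| ≤ 2π√2 ∫‖w‖²` for every smooth `w`
  (pointwise Lemma S, `AbcFlowFrobeniusConstants.abs_inner_strain_abcFlow_le`);
* `abc_l2_tail_form_le` — for every smooth tail field `w` (`fourierTruncate N w = 0`), `ν ≥ 0`, `x ∈ ℝ`:
  `(ν/4π²)∫⟪Δw, w⟫ − (1/2π)∫⟪(U·∇)w + (w·∇)U, w⟫ − x∫‖w‖² ≤ (−ν(N² + 1) + √2 − x)·∫‖w‖²`
  (transport term zero by incompressibility of `U`, Green + high-mode Poincaré for the viscous term):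
  the `2π`'s cancel and the coefficient is literally `−m_t = −(x + ν(K+1)² − s)` with `(K+1)² ↔ N²+1`.

Mathlib + `AbcFlowFrobeniusConstants` + `HighModePoincare` + the torus calculus; no new definitions.
-/

noncomputable section

namespace Summit.NavierStokesRegularity.FluidComputer.AbcFlowL2TailForm

open Literature.Analysis.FluidPDE Literature.Analysis.FunctionSpaces
open Literature.Analysis.FunctionSpaces.Torus MeasureTheory
open Summit.NavierStokesRegularity.FluidComputer.AbcFlowFrobeniusConstants
open Summit.NavierStokesRegularity.FluidComputer.HighModePoincare
open scoped RealInnerProductSpace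

/-- **The stretching term of the ABC linearisation in `L²`: `|∫⟪(w·∇)U, w⟫| ≤ 2π√2·∫‖w‖²`** for
`U = abc(1,1,1)` on the unit torus and every smooth `w` — pointwise Lemma S
(`abs_inner_strain_abcFlow_le`), integrated. -/
theorem abs_integral_inner_stretch_abcFlow_le {w : UnitAddTorus (Fin 3) → EuclideanSpace ℝ (Fin 3)}
    (hw : IsSmooth w) :
    |∫ x, ⟪convect w (Torus.abcFlow 1 1 1) x, w x⟫| ≤ 2 * Real.pi * Real.sqrt 2 * ∫ x, ‖w x‖ ^ 2 := by
  set U := Torus.abcFlow (1:ℝ) 1 1 with hU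
  have hUs : IsSmooth U := Torus.isSmooth_abcFlow 1 1 1
  have hpt : ∀ x, |⟪convect w U x, w x⟫| ≤ 2 * Real.pi * Real.sqrt 2 * ‖w x‖ ^ 2 := by
    intro x
    have e : convect w U x = ∑ j, w x j • partialDeriv j U x :=
      fderiv_apply_eq_sum_partialDeriv (hUs.isContDiff (by simp)) x (w x)
    rw [e]
    exact abs_inner_strain_abcFlow_le x (w x)
  rw [← integral_const_mul]
  refine abs_integral_le_integral_abs.trans (integral_mono_of_nonneg
    (ae_of_all _ fun x => abs_nonneg _) ((hw.norm_sq.integrable).const_mul _)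
    (ae_of_all _ hpt))

/-- **The `L²` tail form of the ABC linearisation (kernel form of `m_t = x + ν(K+1)² − √2`).**
For `U = abc(1,1,1)` on the unit torus, every smooth tail field `w` with `fourierTruncate N w = 0`,
`ν ≥ 0` and `x ∈ ℝ`:
`(ν/4π²)∫⟪Δw, w⟫ − (1/2π)∫⟪(U·∇)w + (w·∇)U, w⟫ − x∫‖w‖² ≤ (−ν(N²+1) + √2 − x)·∫‖w‖²`. -/
theorem abc_l2_tail_form_le {w : UnitAddTorus (Fin 3) → EuclideanSpace ℝ (Fin 3)} (hw : IsSmooth w)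
    {N : ℕ} (h0 : fourierTruncate N w = fun _ => 0) {ν : ℝ} (hν : 0 ≤ ν) (x : ℝ) :
    ν / (4 * Real.pi ^ 2) * (∫ y, ⟪laplacian w y, w y⟫)
      - 1 / (2 * Real.pi) * (∫ y, ⟪convect (Torus.abcFlow 1 1 1) w y + convect w (Torus.abcFlow 1 1 1) y, w y⟫)
      - x * (∫ y, ‖w y‖ ^ 2)
      ≤ (-(ν * ((N : ℝ) ^ 2 + 1)) + Real.sqrt 2 - x) * (∫ y, ‖w y‖ ^ 2) := by
  set U := Torus.abcFlow (1:ℝ) 1 1 with hU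
  have hUs : IsSmooth U := Torus.isSmooth_abcFlow 1 1 1
  have hUd : IsDivFree U := Torus.isDivFree_abcFlow 1 1 1
  set E : ℝ := ∫ y, ‖w y‖ ^ 2 with hE
  have hE0 : 0 ≤ E := integral_nonneg fun y => sq_nonneg _
  have hπ : 0 < Real.pi := Real.pi_pos
  -- (1) viscous term: ∫⟪Δw, w⟫ = −‖∇w‖² ≤ −4π²(N²+1) E
  have hvisc : ∫ y, ⟪laplacian w y, w y⟫ ≤ -(4 * Real.pi ^ 2 * ((N : ℝ) ^ 2 + 1) * E) := by
    rw [integral_inner_laplacian_self_eq_neg_gradNormSq_of_isSmooth hw]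
    have h := integral_norm_sq_le_of_truncate_eq_zero hw h0
    linarith
  -- (2) transport term vanishes, stretching term bounded by Lemma S
  have hi1 : Integrable (fun y => ⟪convect U w y, w y⟫) volume :=
    (((hUs.convect hw).continuous).inner hw.continuous).integrable_of_hasCompactSupport
      (HasCompactSupport.of_compactSpace _)
  have hi2 : Integrable (fun y => ⟪convect w U y, w y⟫) volume :=
    (((hw.convect hUs).continuous).inner hw.continuous).integrable_of_hasCompactSupport
      (HasCompactSupport.of_compactSpace _)
  have hsplit : ∫ y, ⟪convect U w y + convect w U y, w y⟫
      = (∫ y, ⟪convect U w y, w y⟫) + ∫ y, ⟪convect w U y, w y⟫ := by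
    simp_rw [inner_add_left]
    exact integral_add hi1 hi2
  have htr : ∫ y, ⟪convect U w y, w y⟫ = 0 := integral_inner_convect_self_right_eq_zero hUs hUd hw
  have hst : |∫ y, ⟪convect w U y, w y⟫| ≤ 2 * Real.pi * Real.sqrt 2 * E :=
    abs_integral_inner_stretch_abcFlow_le hw
  have hconv : -(1 / (2 * Real.pi)) * (∫ y, ⟪convect U w y + convect w U y, w y⟫) ≤ Real.sqrt 2 * E := by
    rw [hsplit, htr, zero_add]
    have h1 : -(∫ y, ⟪convect w U y, w y⟫) ≤ 2 * Real.pi * Real.sqrt 2 * E := (neg_le_abs _).trans hst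
    have h2 : -(1 / (2 * Real.pi)) * (∫ y, ⟪convect w U y, w y⟫)
        = (1 / (2 * Real.pi)) * (-(∫ y, ⟪convect w U y, w y⟫)) := by ring
    rw [h2]
    calc (1 / (2 * Real.pi)) * (-(∫ y, ⟪convect w U y, w y⟫))
        ≤ (1 / (2 * Real.pi)) * (2 * Real.pi * Real.sqrt 2 * E) :=
          mul_le_mul_of_nonneg_left h1 (by positivity)
      _ = Real.sqrt 2 * E := by field_simp
  -- (3) assemble
  have hv' : ν / (4 * Real.pi ^ 2) * (∫ y, ⟪laplacian w y, w y⟫) ≤ -(ν * ((N : ℝ) ^ 2 + 1) * E) := by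
    have h := mul_le_mul_of_nonneg_left hvisc (by positivity : (0:ℝ) ≤ ν / (4 * Real.pi ^ 2))
    have e : ν / (4 * Real.pi ^ 2) * -(4 * Real.pi ^ 2 * ((N : ℝ) ^ 2 + 1) * E)
        = -(ν * ((N : ℝ) ^ 2 + 1) * E) := by field_simp
    rwa [e] at h
  nlinarith [hv', hconv]

end Summit.NavierStokesRegularity.FluidComputer.AbcFlowL2TailForm
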